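import Literature.AlgebraicGeometry.Motives.TateConjectureKunnethFullyAlgebraicFactor
import HarnessLib

/-!
# Dimension counts for the Künneth decomposition over a factor with fully algebraic cohomology:
# `dim K·Aᶜ(X × Z) = Σ_{p+q=c} dim K·Aᵖ(X) · b_{2q}(Z)` and
# `dim (H^{2c}(X × Z)(c))^Γ = Σ_{p+q=c} dim (H^{2p}(X)(p))^Γ · b_{2q}(Z)`

Topic `Literature/AlgebraicGeometry/Motives`; THEOREMS ONLY (no definition, no instance, no named fact;
D-0026).

Rows g53-#1 ∕ g53-#2 (`AlgebraicClassesKunnethFullyAlgebraicFactor`, `TateConjectureKunnethFullyAlgebraicFactor`)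
decomposed, for `Z` smooth projective with `K·A^q(Z) = H^{2q}(Z)` for all `q` and `b_{odd}(Z) = 0`, the `K`-span
of the algebraic classes and the Galois invariants of `H^{2c}(X × Z)(c)` along the Künneth isomorphism:
`K·Aᶜ(X × Z) = Σ_{p+q=c} K·Aᵖ(X) × H^{2q}(Z)`, `(H^{2c}(X × Z)(c))^Γ = Σ_{p+q=c} (H^{2p}(X)(p))^Γ × H^{2q}(Z)`
(Kahn 2020 Prop. 6.11 (6.4.1) «`Aⁿ(X × 𝐏¹) ≃ Aⁿ(X) ⊕ A^{n−1}(X)`»; Milne 2007 Cor. 2.2, proof: «the similar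
decomposition of `H²(X × Y, ℚ_ℓ(1))` given by the Künneth formula»).  This file counts dimensions — the
analogue for these two subspaces of the tree's Künneth formula for Betti numbers
`b_d(X × Z) = Σ_{i+j=d} bᵢ(X) bⱼ(Z)` (`KunnethFormulaBettiNumbers`):

* §1 (linear algebra) `dim (U ⊗ W) = dim U · dim W` for the subspace `U ⊗ W ⊆ V ⊗ W`
  (`finrank_map₂_mk_top`; Roman 2008 Th. 14.6: bases).
* §2 (any `W`, any `X`, `Z`) **a Künneth-saturated subspace `A ⊆ Hᵈ(X × Z)` — one containing every class all
  of whose Künneth components are Künneth components of members of `A` — is isomorphic to the product of its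
  component images**, so `dim A = Σ_{a+b=d} dim A_{a,b}` (`finrank_eq_sum_finrank_map_kunnethComponent`);
  with `b_{odd}(Z) = 0` and even pieces of the form `U_p ⊗ H^{2q}(Z)`:
  **`dim A = Σ_{p+q=c} dim U_p · b_{2q}(Z)`** (`finrank_eq_sum_of_kunneth_pieces`).
* §3 `Z` with fully algebraic cohomology: the component images of `K·Aᶜ(X × Z)` are the `K·Aᵖ(X) ⊗ H^{2q}(Z)`
  (`map_kunnethComponent_algebraicClasses_tensor`), hence **`dim K·Aᶜ(X × Z) = Σ_{p+q=c} dim K·Aᵖ(X) · b_{2q}(Z)`**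
  (`finrank_algebraicClasses_tensor`, and `_eq_sum_range`).
* §4 Galois side: `map_kunnethComponent_invariants_tensor`, **`finrank_invariants_tensor`** (the same count for
  Tate classes), and the DEFECT FORMULA `dim (H^{2c}(X × Z)(c))^Γ − dim K·Aᶜ(X × Z) = Σ_{p+q=c}
  (dim (H^{2p}(X)(p))^Γ − dim K·Aᵖ(X)) · b_{2q}(Z)` (`finrank_invariants_sub_finrank_algebraicClasses_tensor`):
  the failure of `T` on `X × Z` is the `b_{2•}(Z)`-weighted failure of `T` on `X`.
* §5 `Z = 𝐏ʳ` over a finite field (`b_{2q}(𝐏ʳ) = [q ≤ r]`): `dim K·Aᶜ(X × 𝐏ʳ) = Σ_{q ≤ min(c,r)} dim K·A^{c−q}(X)`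
  (`finrank_algebraicClasses_tensor_projectiveSpace`), `finrank_invariants_tensor_projectiveSpace`.

HC is not touched.

## References

* [Kahn2020] B. Kahn, *Zeta and L-Functions of Varieties and Motives* (2020), §3.6 axiom (vi) (Künneth),
  §6.4 Prop. 6.11 (6.4.1), Prop. 6.12.
* [Milne2007TateFiniteFieldsAIM] J. S. Milne, *The Tate conjecture over finite fields (AIM talk)*,
  arXiv:0709.3040, §2 Cor. 2.2 (proof).
* [Fulton1998] W. Fulton, *Intersection Theory* (1998), Th. 3.3 (b).
* [Kleiman1968AlgebraicCycles] S. Kleiman, *Algebraic cycles and the Weil conjectures* (1968), §1.2 (A)–(B).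
* [Tate1994] J. Tate, *Conjectures on algebraic cycles in ℓ-adic cohomology* (1994), §1.
* [Roman2008] S. Roman, *Advanced Linear Algebra* (2008), Ch. 14 Th. 14.5–14.6.
* [Hartshorne1977] R. Hartshorne, *Algebraic Geometry* (1977), App. C Ex. 5.2.
* Tree: rows g53-#1, g53-#2; `AbelianVarietyHopf` (`kunnethComponent_sum_extTensor`, `ext_kunnethComponent`),
  `KunnethFormulaBettiNumbers` (the Betti-number count, same shape), `ProjectiveSpaceFiniteFieldCohomology`.

## Provenance

Lane `lit-hodgefound` (summit `HodgeConjecture`, Track 2 foundations library, Layer B: motives), seat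
`lit-hodgefound-p29` (literature-prover, generation 53, row g53-#4).
-/

universe u v

open CategoryTheory AlgebraicGeometry MonoidalCategory CartesianMonoidalCategory
open Finset.HasAntidiagonal (antidiagonal mem_antidiagonal)
open scoped TensorProduct

noncomputable section

/-! ### §1 Linear algebra: `dim (U ⊗ W) = dim U · dim W` inside `V ⊗ W` -/

namespace Literature.LinearAlgebra.TensorContraction

variable {K : Type*} [Field K] {V W : Type*} [AddCommGroup V] [Module K V] [AddCommGroup W] [Module K W]

/-- **`dim (U ⊗ W) = dim U · dim W`** for the subspace `U ⊗ W ⊆ V ⊗ W` spanned by the `u ⊗ w`, `u ∈ U`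
(`U ⊗ W → V ⊗ W` is injective over a field; bases `uᵢ ⊗ wⱼ`, Roman Th. 14.6).
[cite: Roman2008, Ch. 14 Th. 14.5–14.6] -/
theorem finrank_map₂_mk_top [Module.Finite K V] [Module.Finite K W] (U : Submodule K V) :
    Module.finrank K (Submodule.map₂ (TensorProduct.mk K V W) U ⊤) =
      Module.finrank K U * Module.finrank K W := by
  rw [← TensorProduct.range_mapIncl,
    LinearMap.finrank_range_of_inj (Module.Flat.tensorProduct_mapIncl_injective_of_right (p := U) (q := ⊤)),
    Module.finrank_tensorProduct, finrank_top]

end Literature.LinearAlgebra.TensorContraction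

namespace Literature.AlgebraicGeometry.Motives

namespace WeilCohomology

open Literature.LinearAlgebra.TensorContraction

variable {k : Type u} [Field k] {K : Type v} [Field K] [CharZero K] (W : WeilCohomology k K)
variable {n m : ℕ} {X Z : SchemeOver k}

/-! ### §2 Künneth-saturated subspaces of `Hᵈ(X × Z)` -/

/-- **A Künneth-saturated subspace is the product of its component images.**  Let `A ⊆ Hᵈ(X × Z)` contain
every class `z` each of whose Künneth components `z_{a,b}` is the `(a, b)`-component of some member of `A`.
Then `z ↦ (z_{a,b})_{a+b=d}` is a linear isomorphism `A ≅ Π_{a+b=d} A_{a,b}` onto the product of the component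
images (inverse: `Σ ext`), so `dim A = Σ_{a+b=d} dim A_{a,b}` (uniqueness of the Künneth decomposition,
axiom (B)). [cite: Kleiman1968AlgebraicCycles, §1.2 (B)] [cite: Kahn2020, §3.6 axiom (vi)] -/
theorem finrank_eq_sum_finrank_map_kunnethComponent (hX : IsSmoothProjective n X)
    (hZ : IsSmoothProjective m Z) {d : ℕ} (A : Submodule K (W.obj (X ⊗ Z) d))
    (hA : ∀ z : W.obj (X ⊗ Z) d, (∀ (a b : ℕ) (h : a + b = d),
      W.kunnethComponent hX hZ a b h z ∈ A.map (W.kunnethComponent hX hZ a b h)) → z ∈ A) :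
    Module.finrank K A =
      ∑ ij : ↥(antidiagonal d), Module.finrank K
        (A.map (W.kunnethComponent hX hZ ij.1.1 ij.1.2 (mem_antidiagonal.mp ij.2))) := by
  classical
  haveI : ∀ ij : ↥(antidiagonal d), Module.Finite K (W.obj X ij.1.1 ⊗[K] W.obj Z ij.1.2) := fun ij ↦ by
    haveI := W.finite_obj hX ij.1.1
    haveI := W.finite_obj hZ ij.1.2
    infer_instance
  -- the comparison map `z ↦ (z_{a,b})`
  let Φ : A →ₗ[K] (Π ij : ↥(antidiagonal d),
      A.map (W.kunnethComponent hX hZ ij.1.1 ij.1.2 (mem_antidiagonal.mp ij.2))) :=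
    LinearMap.pi fun ij ↦ LinearMap.codRestrict _
      ((W.kunnethComponent hX hZ ij.1.1 ij.1.2 (mem_antidiagonal.mp ij.2)).domRestrict A)
      fun z ↦ ⟨z.1, z.2, rfl⟩
  have hΦ : ∀ (z : A) ij, (Φ z ij : W.obj X ij.1.1 ⊗[K] W.obj Z ij.1.2) =
      W.kunnethComponent hX hZ ij.1.1 ij.1.2 (mem_antidiagonal.mp ij.2) z := fun _ _ ↦ rfl
  have hinj : Function.Injective Φ := fun z₁ z₂ h ↦ Subtype.ext (W.ext_kunnethComponent hX hZ fun a b hab ↦ by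
    have h1 := congrArg Subtype.val (congrFun h (kIdx hab))
    rwa [hΦ, hΦ] at h1)
  have hsurj : Function.Surjective Φ := fun t ↦ by
    let z : W.obj (X ⊗ Z) d := ∑ ij : ↥(antidiagonal d),
      W.extTensor (mem_antidiagonal.mp ij.2) (t ij : W.obj X ij.1.1 ⊗[K] W.obj Z ij.1.2)
    have hz : ∀ (a b : ℕ) (h : a + b = d), W.kunnethComponent hX hZ a b h z = (t (kIdx h) : _) :=
      fun a b h ↦ W.kunnethComponent_sum_extTensor hX hZ (fun ij ↦ (t ij : W.obj X ij.1.1 ⊗[K] W.obj Z ij.1.2)) h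
    refine ⟨⟨z, hA z fun a b h ↦ by rw [hz a b h]; exact (t (kIdx h)).2⟩, funext fun ij ↦ Subtype.ext ?_⟩
    obtain ⟨⟨a, b⟩, hab⟩ := ij
    rw [hΦ]
    exact hz a b (mem_antidiagonal.mp hab)
  rw [(LinearEquiv.ofBijective Φ ⟨hinj, hsurj⟩).finrank_eq, Module.finrank_pi_fintype]

/-- **`dim A = Σ_{p+q=c} dim U_p · b_{2q}(Z)`** for a Künneth-saturated `A ⊆ H^{2c}(X × Z)` whose even component
images are `A_{2p,2q} = U_p ⊗ H^{2q}(Z)`, when `b_{odd}(Z) = 0` (the odd components vanish). Sum over the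
antidiagonal `{(p, q) : p + q = c}`. [cite: Kleiman1968AlgebraicCycles, §1.2 (A)–(B)] [cite: Kahn2020, §3.6 axiom (vi)]
[cite: Roman2008, Ch. 14 Th. 14.6] -/
theorem finrank_eq_sum_of_kunneth_pieces (hX : IsSmoothProjective n X) (hZ : IsSmoothProjective m Z)
    (hZodd : ∀ j, Odd j → Module.finrank K (W.obj Z j) = 0) {c : ℕ}
    (A : Submodule K (W.obj (X ⊗ Z) (2 * c))) (U : ∀ p : ℕ, Submodule K (W.obj X (2 * p)))
    (hA : ∀ z : W.obj (X ⊗ Z) (2 * c), (∀ (a b : ℕ) (h : a + b = 2 * c),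
      W.kunnethComponent hX hZ a b h z ∈ A.map (W.kunnethComponent hX hZ a b h)) → z ∈ A)
    (heven : ∀ (p q : ℕ) (h : 2 * p + 2 * q = 2 * c), A.map (W.kunnethComponent hX hZ (2 * p) (2 * q) h) =
      Submodule.map₂ (TensorProduct.mk K (W.obj X (2 * p)) (W.obj Z (2 * q))) (U p) ⊤) :
    Module.finrank K A =
      ∑ pq ∈ antidiagonal c, Module.finrank K (U pq.1) * Module.finrank K (W.obj Z (2 * pq.2)) := by
  classical
  rw [W.finrank_eq_sum_finrank_map_kunnethComponent hX hZ A hA]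
  -- summand as a function on all of `ℕ × ℕ`
  let g : ℕ × ℕ → ℕ := fun ab ↦ if h : ab.1 + ab.2 = 2 * c then
    Module.finrank K (A.map (W.kunnethComponent hX hZ ab.1 ab.2 h)) else 0
  have hg : ∀ ij : ↥(antidiagonal (2 * c)), Module.finrank K
      (A.map (W.kunnethComponent hX hZ ij.1.1 ij.1.2 (mem_antidiagonal.mp ij.2))) =
        g ij.1 := fun ij ↦ by
    simp only [g, dif_pos (mem_antidiagonal.mp ij.2)]
  rw [Fintype.sum_congr _ _ hg, Finset.sum_coe_sort (antidiagonal (2 * c)) g]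
  -- the even sub-antidiagonal
  let e : ℕ × ℕ ↪ ℕ × ℕ := ⟨fun pq ↦ (2 * pq.1, 2 * pq.2), fun pq pq' h ↦ by
    simp only [Prod.mk.injEq] at h
    exact Prod.ext (by omega) (by omega)⟩
  have hS : (antidiagonal c).map e ⊆ antidiagonal (2 * c) := by
    intro ab hab
    rw [Finset.mem_map] at hab
    obtain ⟨pq, hpq, rfl⟩ := hab
    rw [mem_antidiagonal] at hpq ⊢
    change 2 * pq.1 + 2 * pq.2 = 2 * c
    omega
  rw [← Finset.sum_subset hS, Finset.sum_map]
  · refine Finset.sum_congr rfl fun pq hpq ↦ ?_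
    rw [mem_antidiagonal] at hpq
    haveI := W.finite_obj hX (2 * pq.1)
    haveI := W.finite_obj hZ (2 * pq.2)
    have h2 : 2 * pq.1 + 2 * pq.2 = 2 * c := by omega
    change g (2 * pq.1, 2 * pq.2) = _
    simp only [g, dif_pos h2]
    rw [heven pq.1 pq.2 h2, finrank_map₂_mk_top]
  · -- off the even sub-antidiagonal the second degree is odd and the component image vanishes
    intro ab hab hne
    rw [mem_antidiagonal] at hab
    have hodd : Odd ab.2 := by
      rcases Nat.even_or_odd ab.2 with hb | hb
      · exfalso
        refine hne (Finset.mem_map.mpr ⟨(c - ab.2 / 2, ab.2 / 2), ?_, ?_⟩)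
        · rw [mem_antidiagonal]
          have := Nat.even_iff.mp hb
          change c - ab.2 / 2 + ab.2 / 2 = c
          omega
        · have := Nat.even_iff.mp hb
          exact Prod.ext (by change 2 * (c - ab.2 / 2) = ab.1; omega) (by change 2 * (ab.2 / 2) = ab.2; omega)
      · exact hb
    simp only [g, dif_pos hab]
    have hbot : A.map (W.kunnethComponent hX hZ ab.1 ab.2 hab) = ⊥ := by
      refine (Submodule.eq_bot_iff _).mpr ?_
      rintro _ ⟨z, -, rfl⟩
      exact W.kunnethComponent_eq_zero_of_odd_right hX hZ hZodd hodd hab z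
    rw [hbot, finrank_bot]

/-! ### §3 `dim K·Aᶜ(X × Z) = Σ_{p+q=c} dim K·Aᵖ(X) · b_{2q}(Z)` -/

/-- **The `(2p, 2q)` Künneth components of `K·Aᶜ(X × Z)` fill `K·Aᵖ(X) ⊗ H^{2q}(Z)`** for `Z` with
`K·A^q(Z) = H^{2q}(Z)` for all `q` (`⊆`: row g53-#1; `⊇`: `x × w` is algebraic and `(x × w)_{2p,2q} = x ⊗ w`).
[cite: Kahn2020, §6.4 Prop. 6.11 (6.4.1)] [cite: Kleiman1968AlgebraicCycles, §1.2 (B), §1.3] -/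
theorem map_kunnethComponent_algebraicClasses_tensor (hX : IsSmoothProjective n X)
    (hZ : IsSmoothProjective m Z) (hZalg : ∀ q, W.algebraicClasses Z q = ⊤) {p q c : ℕ}
    (h : 2 * p + 2 * q = 2 * c) :
    (W.algebraicClasses (X ⊗ Z) c).map (W.kunnethComponent hX hZ (2 * p) (2 * q) h) =
      Submodule.map₂ (TensorProduct.mk K (W.obj X (2 * p)) (W.obj Z (2 * q))) (W.algebraicClasses X p) ⊤ := by
  refine le_antisymm ?_ fun t ht ↦ ?_
  · rintro _ ⟨z, hz, rfl⟩
    by_cases hq : q ≤ m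
    · exact W.kunnethComponent_mem_map₂_of_mem_algebraicClasses hX hZ (q' := m - q) (by omega) (by omega)
        (hZalg _) h hz
    · exact W.kunnethComponent_mem_map₂_of_lt hX hZ (by omega) h _ z
  · exact ⟨W.extTensor h t, W.map₂_externalCup_algebraicClasses_top_le hX hZ (by omega) (hZalg q) h
      (W.extTensor_mem_map₂_externalCup h _ _ ht), W.kunnethComponent_extTensor_self hX hZ h t⟩

/-- **`dim_K K·Aᶜ(X × Z) = Σ_{p+q=c} dim_K K·Aᵖ(X) · b_{2q}(Z)`** for `Z` smooth projective with
`K·A^q(Z) = H^{2q}(Z)` for all `q` and `b_{odd}(Z) = 0` — the dimension count of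
`K·Aᶜ(X × Z) = ⊕_{p+q=c} K·Aᵖ(X) ⊗ H^{2q}(Z)` (Kahn Prop. 6.11–6.12 for `Z = 𝐏ʳ`; Fulton Th. 3.3 (b)).
[cite: Kahn2020, §6.4 Prop. 6.11 (6.4.1) and Prop. 6.12] [cite: Fulton1998, Th. 3.3 (b)]
[cite: Kleiman1968AlgebraicCycles, §1.2 (B)] -/
theorem finrank_algebraicClasses_tensor (hX : IsSmoothProjective n X) (hZ : IsSmoothProjective m Z)
    (hZalg : ∀ q, W.algebraicClasses Z q = ⊤) (hZodd : ∀ j, Odd j → Module.finrank K (W.obj Z j) = 0)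
    (c : ℕ) :
    Module.finrank K (W.algebraicClasses (X ⊗ Z) c) =
      ∑ pq ∈ antidiagonal c,
        Module.finrank K (W.algebraicClasses X pq.1) * Module.finrank K (W.obj Z (2 * pq.2)) := by
  refine W.finrank_eq_sum_of_kunneth_pieces hX hZ hZodd _ (fun p ↦ W.algebraicClasses X p) (fun z hz ↦ ?_)
    (fun p q h ↦ W.map_kunnethComponent_algebraicClasses_tensor hX hZ hZalg h)
  refine (W.mem_algebraicClasses_tensor_iff hX hZ hZalg hZodd z).mpr fun p q h ↦ ?_
  rw [← W.map_kunnethComponent_algebraicClasses_tensor hX hZ hZalg h]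
  exact hz _ _ h

/-- `dim_K K·Aᶜ(X × Z) = Σ_{p ≤ c} dim_K K·Aᵖ(X) · b_{2(c−p)}(Z)`, the same count summed over `p ∈ {0, …, c}`.
[cite: Kahn2020, §6.4 Prop. 6.11 (6.4.1) and Prop. 6.12] [cite: Fulton1998, Th. 3.3 (b)] -/
theorem finrank_algebraicClasses_tensor_eq_sum_range (hX : IsSmoothProjective n X)
    (hZ : IsSmoothProjective m Z) (hZalg : ∀ q, W.algebraicClasses Z q = ⊤)
    (hZodd : ∀ j, Odd j → Module.finrank K (W.obj Z j) = 0) (c : ℕ) :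
    Module.finrank K (W.algebraicClasses (X ⊗ Z) c) =
      ∑ p ∈ Finset.range (c + 1),
        Module.finrank K (W.algebraicClasses X p) * Module.finrank K (W.obj Z (2 * (c - p))) := by
  rw [W.finrank_algebraicClasses_tensor hX hZ hZalg hZodd c, Finset.Nat.sum_antidiagonal_eq_sum_range_succ_mk]

end WeilCohomology

/-! ### §4 The Galois side: `dim (H^{2c}(X × Z)(c))^Γ = Σ_{p+q=c} dim (H^{2p}(X)(p))^Γ · b_{2q}(Z)` -/

namespace GaloisWeilCohomology

open Literature.LinearAlgebra.TensorContraction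

variable {k : Type u} [Field k] {K : Type v} [Field K] [CharZero K]
  {χ : Field.absoluteGaloisGroup k →* Kˣ} (E : GaloisWeilCohomology k K χ)
variable {n m : ℕ} {X Z : SchemeOver k}

/-- **The `(2p, 2q)` Künneth components of the Tate classes of `X × Z` fill `(H^{2p}(X)(p))^Γ ⊗ H^{2q}(Z)`**
for `Z` with fully algebraic cohomology (row g53-#2). [cite: Milne2007TateFiniteFieldsAIM, Cor. 2.2 (proof)]
[cite: Tate1994, §1] -/
theorem map_kunnethComponent_invariants_tensor (hX : IsSmoothProjective n X) (hZ : IsSmoothProjective m Z)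
    (hZalg : ∀ q, E.algebraicClasses Z q = ⊤) (hZodd : ∀ j, Odd j → Module.finrank K (E.obj Z j) = 0)
    {p q c : ℕ} (h : 2 * p + 2 * q = 2 * c) :
    (E.ρTwist (X ⊗ Z) (2 * c) c).invariants.map (E.kunnethComponent hX hZ (2 * p) (2 * q) h) =
      Submodule.map₂ (TensorProduct.mk K (E.obj X (2 * p)) (E.obj Z (2 * q)))
        (E.ρTwist X (2 * p) p).invariants ⊤ := by
  refine le_antisymm ?_ fun t ht ↦ ?_
  · rintro _ ⟨z, hz, rfl⟩
    exact (E.mem_invariants_tensor_iff hX hZ hZalg hZodd z).mp hz p q h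
  · exact ⟨E.extTensor h t, E.map₂_externalCup_invariants_le hX hZ (by omega) (hZalg q) h
      (E.extTensor_mem_map₂_externalCup h _ _ ht), E.kunnethComponent_extTensor_self hX hZ h t⟩

/-- **`dim_K (H^{2c}(X × Z)(c))^Γ = Σ_{p+q=c} dim_K (H^{2p}(X)(p))^Γ · b_{2q}(Z)`** for `Z` smooth projective
with `K·A^q(Z) = H^{2q}(Z)` for all `q` and `b_{odd}(Z) = 0`: the Tate classes of `X × Z` counted through the
Künneth formula. [cite: Milne2007TateFiniteFieldsAIM, Cor. 2.2 (proof)] [cite: Tate1994, §1]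
[cite: Kahn2020, §3.6 axiom (vi)] -/
theorem finrank_invariants_tensor (hX : IsSmoothProjective n X) (hZ : IsSmoothProjective m Z)
    (hZalg : ∀ q, E.algebraicClasses Z q = ⊤) (hZodd : ∀ j, Odd j → Module.finrank K (E.obj Z j) = 0)
    (c : ℕ) :
    Module.finrank K (E.ρTwist (X ⊗ Z) (2 * c) c).invariants =
      ∑ pq ∈ antidiagonal c,
        Module.finrank K (E.ρTwist X (2 * pq.1) pq.1).invariants * Module.finrank K (E.obj Z (2 * pq.2)) := by
  refine E.finrank_eq_sum_of_kunneth_pieces hX hZ hZodd _ (fun p ↦ (E.ρTwist X (2 * p) p).invariants)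
    (fun z hz ↦ ?_) (fun p q h ↦ E.map_kunnethComponent_invariants_tensor hX hZ hZalg hZodd h)
  refine (E.mem_invariants_tensor_iff hX hZ hZalg hZodd z).mpr fun p q h ↦ ?_
  rw [← E.map_kunnethComponent_invariants_tensor hX hZ hZalg hZodd h]
  exact hz _ _ h

/-- **The defect formula: `dim (H^{2c}(X × Z)(c))^Γ − dim K·Aᶜ(X × Z) = Σ_{p+q=c}
(dim (H^{2p}(X)(p))^Γ − dim K·Aᵖ(X)) · b_{2q}(Z)`** — the codimension of the algebraic classes inside the Tate
classes of `X × Z` is the `b_{2•}(Z)`-weighted sum of the codimensions for `X` (it vanishes iff `Tᵖ(X)` holds for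
every `p` with `b_{2(c−p)}(Z) ≠ 0`, row g53-#2 `tateConjectureFor_tensor_iff`).
[cite: Milne2007TateFiniteFieldsAIM, Cor. 2.2] [cite: Tate1994, §1 (Conjecture Tᵖ)] -/
theorem finrank_invariants_sub_finrank_algebraicClasses_tensor (hX : IsSmoothProjective n X)
    (hZ : IsSmoothProjective m Z) (hZalg : ∀ q, E.algebraicClasses Z q = ⊤)
    (hZodd : ∀ j, Odd j → Module.finrank K (E.obj Z j) = 0) (c : ℕ) :
    Module.finrank K (E.ρTwist (X ⊗ Z) (2 * c) c).invariants -
        Module.finrank K (E.algebraicClasses (X ⊗ Z) c) =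
      ∑ pq ∈ antidiagonal c,
        (Module.finrank K (E.ρTwist X (2 * pq.1) pq.1).invariants - Module.finrank K (E.algebraicClasses X pq.1)) *
          Module.finrank K (E.obj Z (2 * pq.2)) := by
  rw [E.finrank_invariants_tensor hX hZ hZalg hZodd c, E.finrank_algebraicClasses_tensor hX hZ hZalg hZodd c]
  have hle : ∀ pq ∈ antidiagonal c,
      Module.finrank K (E.algebraicClasses X pq.1) * Module.finrank K (E.obj Z (2 * pq.2)) ≤
        Module.finrank K (E.ρTwist X (2 * pq.1) pq.1).invariants * Module.finrank K (E.obj Z (2 * pq.2)) :=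
    fun pq _ ↦ by
      haveI := E.finite_obj hX (2 * pq.1)
      exact Nat.mul_le_mul_right _ (Submodule.finrank_mono (E.algebraicClasses_le_invariants hX pq.1))
  rw [← Finset.sum_tsub_distrib _ hle]
  exact Finset.sum_congr rfl fun pq _ ↦ (Nat.sub_mul _ _ _).symm

/-! ### §5 `Z = 𝐏ʳ` over a finite field -/

section ProjectiveSpace

variable [Finite k] {r : ℕ}

/-- **`dim_K K·Aᶜ(X × 𝐏ʳ) = Σ_{p+q=c, q≤r} dim_K K·Aᵖ(X)`** over a finite field, granted the Riemann hypothesis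
for `𝐏ʳ` in `E` (`b_{2q}(𝐏ʳ) = [q ≤ r]`; Kahn Prop. 6.12: `Aᶜ(X × 𝐏ʳ) ≃ ⊕_{q≤r} A^{c−q}(X)`).
[cite: Kahn2020, §6.4 Prop. 6.11 (6.4.1) and Prop. 6.12] [cite: Fulton1998, Th. 3.3 (b)] [cite: Hartshorne1977, App. C Ex. 5.2] -/
theorem finrank_algebraicClasses_tensor_projectiveSpace (hE : E.HasLefschetzTraceFormula)
    (hχ : ((χ (arithFrob k) : Kˣ) : K) = Nat.card k)
    (hRH : E.WeilRiemannHypothesisFor (projectiveSpace r k) r) (hX : IsSmoothProjective n X) (c : ℕ) :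
    Module.finrank K (E.algebraicClasses (X ⊗ projectiveSpace r k) c) =
      ∑ pq ∈ antidiagonal c, if pq.2 ≤ r then Module.finrank K (E.algebraicClasses X pq.1) else 0 := by
  rw [E.finrank_algebraicClasses_tensor hX (isSmoothProjective_projectiveSpace_holds k r)
    (E.algebraicClasses_projectiveSpace_eq_top hE hχ hRH) (fun _ hj ↦ E.finrank_projectiveSpace_of_odd hE hχ hRH hj) c]
  refine Finset.sum_congr rfl fun pq _ ↦ ?_
  split_ifs with hq
  · rw [E.finrank_projectiveSpace_two_mul hE hχ hRH hq, mul_one]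
  · haveI := E.subsingleton_obj (isSmoothProjective_projectiveSpace_holds k r) (i := 2 * pq.2) (by omega)
    have h0 : Module.finrank K (E.obj (projectiveSpace r k) (2 * pq.2)) = 0 := Module.finrank_zero_of_subsingleton
    rw [h0, mul_zero]

/-- **`dim_K (H^{2c}(X × 𝐏ʳ)(c))^Γ = Σ_{p+q=c, q≤r} dim_K (H^{2p}(X)(p))^Γ`** over a finite field (RH for `𝐏ʳ`
in `E`). [cite: Milne2007TateFiniteFieldsAIM, Cor. 2.2 (proof)] [cite: Tate1994, §1] [cite: Hartshorne1977, App. C Ex. 5.2] -/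
theorem finrank_invariants_tensor_projectiveSpace (hE : E.HasLefschetzTraceFormula)
    (hχ : ((χ (arithFrob k) : Kˣ) : K) = Nat.card k)
    (hRH : E.WeilRiemannHypothesisFor (projectiveSpace r k) r) (hX : IsSmoothProjective n X) (c : ℕ) :
    Module.finrank K (E.ρTwist (X ⊗ projectiveSpace r k) (2 * c) c).invariants =
      ∑ pq ∈ antidiagonal c,
        if pq.2 ≤ r then Module.finrank K (E.ρTwist X (2 * pq.1) pq.1).invariants else 0 := by
  rw [E.finrank_invariants_tensor hX (isSmoothProjective_projectiveSpace_holds k r)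
    (E.algebraicClasses_projectiveSpace_eq_top hE hχ hRH) (fun _ hj ↦ E.finrank_projectiveSpace_of_odd hE hχ hRH hj) c]
  refine Finset.sum_congr rfl fun pq _ ↦ ?_
  split_ifs with hq
  · rw [E.finrank_projectiveSpace_two_mul hE hχ hRH hq, mul_one]
  · haveI := E.subsingleton_obj (isSmoothProjective_projectiveSpace_holds k r) (i := 2 * pq.2) (by omega)
    have h0 : Module.finrank K (E.obj (projectiveSpace r k) (2 * pq.2)) = 0 := Module.finrank_zero_of_subsingleton
    rw [h0, mul_zero]

end ProjectiveSpace

end GaloisWeilCohomology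

end Literature.AlgebraicGeometry.Motives

end
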